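import Summits.BirchSwinnertonDyer.Rank1Residual.X4.KolyvaginSqueeze
import Summits.BirchSwinnertonDyer.Rank1Residual.X11b.KolyvaginIndexRecordsKitThree
import Literature.NumberTheory.EllipticCurves.Rank1Residual.Typed.SelmerCardCertificateRankZero
import Literature.NumberTheory.EllipticCurves.Rank1Residual.PrintShape
import Literature.NumberTheory.EllipticCurves.NonEisensteinPrimeOfSurjective
import HarnessLib

/-!
# BSD rank-≤1 residual cell, rank ONE at `p = 3`, `#Ш_an = 9`: the KIT of the Kolyvagin SQUEEZE records — `BSD(E,3)` for a literal
# integer model from `ρ̄_{E,3}` ONTO by two Frobenius witnesses, the published named facts, the per-pair Heegner-index certificate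
# `ord₃ [E(K):ℤy_K] ≤ 1` (UPPER half, Kolyvagin as printed by McCallum) and ONE two-engine `3`-descent count `#Sel^(3)(E/ℚ) = 27`
# (LOWER half with Cassels–Tate) — NO hypothesis on the reduction of `E` at `3`

HONEST FRAMING (cell `b2b-bsdres-*`, verbatim): prove what is provable now; shrink each hard class to its core with
data; no claim beyond stated classes; COMBINATION classes deleted from PUBLISHED theorems only, CONSTRUCTION-shaped
remainder typed; this is not "finishing BSD". X11b (and X11 ∧ r = 1 ∧ p = 3, R6.2), X4, X7, X8 stay
CONSTRUCTION-SHAPED as classes; PER PAIR; nothing booked; NO named fact introduced; NO definition. Unit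
`b2b-bsdres-x11c`, GEN 38 (prover-b2b-bsdres-x11c-g38-0), move «KOLY3-SQUEEZE».

WHAT THIS FILE IS: the `#Ш_an = 9` sibling of the unit's GEN 35 kit `X11b.bsdp_three_of_kolyvaginIndex_of_irr_of_order`
(`X11b/KolyvaginIndexRecordsKitThree.lean`, p550599; there `3 ∤ [E(K):ℤy_K]` and `3 ∤ #Ш_an`) — ONE packaging theorem
composing tree theorems already stated and proved at `p = 3`:
  * prover B's certificate shape `Supersingular.surj_three_of_ainvs_of_irr_of_order`: `ρ̄_{E,3}` ONTO for the literal model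
    from TWO good odd primes `ℓ₁, ℓ₂ ≠ 3` with schema point counts (an irreducible Frobenius and a Frobenius of order `3`;
    Serre 1972 §2.4 Prop. 15);
  * unit `b2b-bsdres-sha-2`'s Kolyvagin squeeze `Rank1Residual.bsdp_of_kolyvagin_index_of_casselsTate_of_pow_dvd`
    (`X4/KolyvaginSqueeze.lean`; ANY odd `p`, analytic rank `≤ 1`, NO reduction hypothesis at `p`): Kolyvagin as printed
    by McCallum 1991 §1 (named facts `kolyvagin`, `Kolyvagin1990_padicValNat_card_sha_le` — registry A20, referee C2
    ROUND 326 PASS-VERBATIM «p = 3 allowed as printed»), the odd-part splitting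
    `#Ш(E/K)[p^∞] = #Ш(E/ℚ)[p^∞]·#Ш(E^{(d_K)}/ℚ)[p^∞]` (JSW 2017 §7.4.1, tree theorem), GZK for `E` and for a `ℚ`-model
    `Wd` of the twist `E^{(d_K)}` of analytic rank `≤ 1`, Cassels–Tate squareness (`exists_casselsTate_pairing`, Silverman
    AEC X.4.14): from `ord_p [E(K):ℤy_K] ≤ k`, `ord_p #Ш_an = 2k` and `p^{2k−1} ∣ #Ш(E/ℚ)` it concludes Miller's `BSD(E,p)`;
  * the typed descent lemma `Typed.exists_sha_torsion_of_pow_rank_lt_card_selmerGroup` (`#Sel^(p)(E/ℚ) > p^{rank}`,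
    `p ∤ #E(ℚ)_tors` ⇒ `Ш(E/ℚ)[p] ≠ 0`), with `rank = r_an = 1` from GZK and `3 ∤ #E(ℚ)_tors` from the IRREDUCIBILITY of
    `E[3]` (`padicValNat_torsionOrder_eq_zero_of_irreducible`; onto ⇒ irreducible,
    `hasIrreducibleModPGaloisRep_of_hasSurjectiveModNGaloisRep`) — so the single descent line `#Sel^(3)(E/ℚ) = 27`
    gives `3 ∣ #Ш(E/ℚ)` (`addOrderOf_dvd_natCard`), i.e. the `k = 1` lower datum.
Global minimality of the literal model is an INPUT `hmin` (a record supplies it by prover B's factored Kraus criterion, as in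
the KOLY3 records). Every numeric hypothesis is a `decide` goal for a literal record; every other hypothesis is a displayed
binder: GZK `hGZK`, Cassels–Tate `hCT`, Kolyvagin `hKo` / `hB`, the Heegner datum (`K`, `N`, `P` with `ord₃ [E(K):ℤP] ≤ 1`),
the twist datum (`Wd` a `ℚ`-model of `E^{(d_K)}` with `r_an(Wd) ≤ 1`), `r_an = 1`, `#Ш_an = q` with `ord₃ q = 2`, and the
certificate `hSel : #Sel^(3)(E/ℚ) = 3 ^ 3` — the binder tuple of the unit's `X11b.bsdp_k<label>_3` KOLY3 records
(referee A R958 / R961, flag-free) extended by `hCT`, the twist datum and `hSel`. Nothing about any particular curve is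
asserted here. Consumers: `X11b/KolyvaginSqueezeRecordsThreeNN.lean` (GEN 38: the SHA-shaped (3, X11b) / (3, X4) /
(3, X8) rank-one residue cells with `#Ш_an = 9`, `3 ∤ #T·∏c`, `ρ̄_{E,3}` onto).

References: W. McCallum, LMS LN 153 (1991) §1 [McCallumLMS1991]; B. H. Gross, LMS LN 153 (1991) [GrossLMS1991];
V. A. Kolyvagin (1990) [KolyvaginEulerSystems1990]; Jetchev–Skinner–Wan 2017 §7.4 [JetchevSkinnerWan2017]; J.-P. Serre,
Invent. Math. 15 (1972) §2.4 Prop. 15 [Serre1972]; J. H. Silverman, *AEC* (2009) X.4.2, X.4.14, VII.3.1 [SilvermanAEC2009];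
B. Mazur (1977) III §5 [Mazur1977]; R. L. Miller, LMS JCM 14 (2011) Def. 1.1 [Miller2011LMS]; A. Kraus (1989) [Kraus1989].
-/

set_option autoImplicit false

noncomputable section

open scoped Classical

open WeierstrassCurve Literature.NumberTheory.EllipticCurves
  Literature.NumberTheory.EllipticCurves.Rank1Residual
  Literature.NumberTheory.EllipticCurves.Rank1Residual.Typed
  Literature.NumberTheory.EllipticCurves.Rank1Residual.X11RankOneCertificates
  Summit.BirchSwinnertonDyer.BirchSwinnertonDyer.Rank1Residual.IntModel
  Summit.BirchSwinnertonDyer.BirchSwinnertonDyer.Rank1Residual.X11RankOne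

namespace Summit.BirchSwinnertonDyer.Rank1Residual.X11b

/-- **`BSD(E,3)` for a literal integer model of analytic rank ONE with `ord₃ #Ш_an = 2`, from the Kolyvagin HEEGNER-INDEX
certificate `ord₃ [E(K):ℤy_K] ≤ 1` and the descent count `#Sel^(3)(E/ℚ) = 27` — NO hypothesis on the reduction at `3`.**
Inputs: (kernel, `decide` / `norm_num` goals for a record) global minimality `hmin` of the literal model; two odd primes
`ℓ₁, ℓ₂ ≠ 3` not dividing `Δ` with `countPoints = nᵢ` and, for `aᵢ = ℓᵢ + 1 − nᵢ`: (i) `X² − a₁X + ℓ₁` root-free over `𝔽₃`,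
(ii) `ℓ₂ ≡ 1`, `a₂ ≡ 2 (mod 3)`, `9 ∤ n₂` (⇒ `ρ̄_{E,3}` onto, Serre 1972 Prop. 15); (binders, displayed) GZK `hGZK`, Cassels–Tate
`hCT`, Kolyvagin as printed (`hKo`, `hB`), the Heegner datum `K`, `N`, `P` with `ord₃ [E(K):ℤP] ≤ 1`, a `ℚ`-model `Wd` of the
twist `E^{(d_K)}` with `r_an(Wd) ≤ 1`, `r_an(E) = 1`, `#Ш_an = q` with `ord₃ q = 2`, and the descent certificate
`#Sel^(3)(E/ℚ) = 3 ^ 3`. Output: Miller's `BSD(E,3)` with `#Ш(E/ℚ)[3^∞] = 9` (upper half Kolyvagin + splitting, lower half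
descent + Cassels–Tate: `Rank1Residual.bsdp_of_kolyvagin_index_of_casselsTate_of_pow_dvd` at `k = 1`). Per pair; no class
statement. [cite: McCallumLMS1991, §1 Theorem (Kolyvagin), p. 296] [cite: Serre1972, §2.4 Prop. 15 and §5.2 (iii)]
[cite: SilvermanAEC2009, Thm. X.4.2(a) and Thm. X.4.14] [cite: Mazur1977, Ch. III §5, p. 157] [cite: Miller2011LMS, §1 and Def. 1.1] -/
theorem bsdp_three_of_kolyvaginIndexLeOne_of_card_selmer_of_irr_of_order (a1 a2 a3 a4 a6 : ℤ)
    (hmin : (⟨a1, a2, a3, a4, a6⟩ : WeierstrassCurve ℚ).IsGloballyMinimal)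
    (ℓ₁ ℓ₂ : ℕ) (hℓ₁ : ℓ₁.Prime) (hℓ₂ : ℓ₂.Prime) (h2₁ : ℓ₁ ≠ 2) (h2₂ : ℓ₂ ≠ 2)
    (h3₁ : ℓ₁ ≠ 3) (h3₂ : ℓ₂ ≠ 3)
    (hΔ₁ : ¬ (ℓ₁ : ℤ) ∣ discOf [a1, a2, a3, a4, a6]) (hΔ₂ : ¬ (ℓ₂ : ℤ) ∣ discOf [a1, a2, a3, a4, a6])
    {n₁ n₂ : ℕ} (hc₁ : countPoints [a1, a2, a3, a4, a6] ℓ₁ = n₁)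
    (hc₂ : countPoints [a1, a2, a3, a4, a6] ℓ₂ = n₂)
    (hirr : ∀ c : ZMod 3, c ^ 2 - (((ℓ₁ : ℤ) + 1 - n₁ : ℤ) : ZMod 3) * c + ℓ₁ ≠ 0)
    (hdet₂ : (ℓ₂ : ZMod 3) = 1) (htr₂ : (((ℓ₂ : ℤ) + 1 - n₂ : ℤ) : ZMod 3) = 2) (hsq : ¬ 9 ∣ n₂)
    (hGZK : rank_eq_analyticRank_of_analyticRank_le_one)
    (hCT : exists_casselsTate_pairing (K := ℚ))
    (W : WeierstrassCurve ℚ) (hW : W = ⟨a1, a2, a3, a4, a6⟩)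
    {N : ℕ} [NeZero N] {K : Type} [Field K] [NumberField K] (hKo : kolyvagin N W K)
    (hB : Kolyvagin1990_padicValNat_card_sha_le N W K) (hK : IsImaginaryQuadratic K)
    (hH : SatisfiesHeegnerHypothesis N K) {P : (W.baseChange K).toAffine.Point}
    (hP : IsHeegnerPoint N W K P) (hnt : ¬ IsOfFinAddOrder P)
    (hI : padicValNat 3 (AddSubgroup.zmultiples P).index ≤ 1)
    (Wd : WeierstrassCurve ℚ) [Wd.IsElliptic]
    (hWd : ∃ C : VariableChange ℚ, C • W.quadraticTwist ((NumberField.discr K : ℤ) : ℚ) = Wd)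
    (hrD : Wd.analyticRank ≤ 1)
    (hr : W.analyticRank = 1) {q : ℚ} (hq : shaAn W = (q : ℂ)) (hv : padicValRat 3 q = 2)
    (hSel : Nat.card (W.selmerGroup (3 : ℤ)) = 3 ^ 3) :
    BSDp W 3 := by
  subst hW
  have h0 : discOf [a1, a2, a3, a4, a6] ≠ 0 := fun h ↦ hΔ₁ (by rw [h]; exact dvd_zero _)
  haveI hE : (⟨a1, a2, a3, a4, a6⟩ : WeierstrassCurve ℚ).IsElliptic :=
    X11b.isElliptic_of_discOf_ne_zero a1 a2 a3 a4 a6 h0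
  haveI := hmin
  haveI : Fact (Nat.Prime 3) := ⟨by norm_num⟩
  -- `ρ̄_{E,3}` onto from the two Frobenius witnesses (Serre 1972 Prop. 15)
  have hρ : Surj (⟨a1, a2, a3, a4, a6⟩ : WeierstrassCurve ℚ) 3 :=
    Supersingular.surj_three_of_ainvs_of_irr_of_order a1 a2 a3 a4 a6 hmin ℓ₁ ℓ₂ hℓ₁ hℓ₂ h2₁ h2₂ h3₁ h3₂
      hΔ₁ hΔ₂ hc₁ hc₂ hirr hdet₂ htr₂ hsq
  -- the LOWER datum `3 ∣ #Ш(E/ℚ)` from the descent count: rank `1` (GZK), no rational `3`-torsion (irreducible `E[3]`)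
  have hrank : (⟨a1, a2, a3, a4, a6⟩ : WeierstrassCurve ℚ).mordellWeilRank = 1 := by
    rw [(hGZK _ hr.le).1, hr]
  have hirr3 : (⟨a1, a2, a3, a4, a6⟩ : WeierstrassCurve ℚ).HasIrreducibleModPGaloisRep 3 :=
    hasIrreducibleModPGaloisRep_of_hasSurjectiveModNGaloisRep _ 3 hρ
  have htors : ¬ 3 ∣ (⟨a1, a2, a3, a4, a6⟩ : WeierstrassCurve ℚ).torsionOrder := by
    have h := padicValNat_torsionOrder_eq_zero_of_irreducible (⟨a1, a2, a3, a4, a6⟩ : WeierstrassCurve ℚ) 3 hirr3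
    haveI := (⟨a1, a2, a3, a4, a6⟩ : WeierstrassCurve ℚ).finite_torsion_point
    intro hdvd
    have hpos : 0 < (⟨a1, a2, a3, a4, a6⟩ : WeierstrassCurve ℚ).torsionOrder := by
      unfold WeierstrassCurve.torsionOrder; exact Nat.card_pos
    have := one_le_padicValNat_of_dvd hpos.ne' hdvd
    omega
  haveI : Finite (⟨a1, a2, a3, a4, a6⟩ : WeierstrassCurve ℚ).sha := (hGZK _ hr.le).2
  obtain ⟨x, hx0, hx3⟩ := exists_sha_torsion_of_pow_rank_lt_card_selmerGroup
    (⟨a1, a2, a3, a4, a6⟩ : WeierstrassCurve ℚ) 3 hrank htors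
    (by have h3 : ((3 : ℕ) : ℤ) = 3 := by norm_num
        rw [h3, hSel]; norm_num)
  have hdvd : 3 ^ (2 * 1 - 1) ∣ (⟨a1, a2, a3, a4, a6⟩ : WeierstrassCurve ℚ).shaOrder := by
    have hord : addOrderOf x = 3 := addOrderOf_eq_prime hx3 hx0
    rw [show 2 * 1 - 1 = 1 from rfl, pow_one, WeierstrassCurve.shaOrder, ← hord]
    exact addOrderOf_dvd_natCard x
  exact bsdp_of_kolyvagin_index_of_casselsTate_of_pow_dvd hGZK hCT _ hr.le K hKo hB hK hH hP hnt 3 (by norm_num) hρ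
    Wd hWd hrD (k := 1) hI hq (by rw [hv]; norm_num) hdvd

/-- **The same kit with the descent certificate as a LOWER BOUND `3 ^ 3 ≤ #Sel^(3)(E/ℚ)`** (for rows whose two descent
engines certify three independent EXACT Selmer elements — `dim Sel^(3)(E/ℚ) ≥ 3`, unconditional — while the equality
`= 3` may rest on a class-group computation): only `#Sel^(3)(E/ℚ) > 3 = 3^{rank}` is used by
`Typed.exists_sha_torsion_of_pow_rank_lt_card_selmerGroup`, so the conclusion `BSD(E,3)` is the same. Inputs and
displayed binders exactly as in `bsdp_three_of_kolyvaginIndexLeOne_of_card_selmer_of_irr_of_order`, with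
`hSel : 3 ^ 3 ≤ Nat.card (W.selmerGroup (3 : ℤ))`. Per pair; no class statement.
[cite: McCallumLMS1991, §1 Theorem (Kolyvagin), p. 296] [cite: Serre1972, §2.4 Prop. 15 and §5.2 (iii)]
[cite: SilvermanAEC2009, Thm. X.4.2(a) and Thm. X.4.14] [cite: Mazur1977, Ch. III §5, p. 157] [cite: Miller2011LMS, §1 and Def. 1.1] -/
theorem bsdp_three_of_kolyvaginIndexLeOne_of_le_card_selmer_of_irr_of_order (a1 a2 a3 a4 a6 : ℤ)
    (hmin : (⟨a1, a2, a3, a4, a6⟩ : WeierstrassCurve ℚ).IsGloballyMinimal)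
    (ℓ₁ ℓ₂ : ℕ) (hℓ₁ : ℓ₁.Prime) (hℓ₂ : ℓ₂.Prime) (h2₁ : ℓ₁ ≠ 2) (h2₂ : ℓ₂ ≠ 2)
    (h3₁ : ℓ₁ ≠ 3) (h3₂ : ℓ₂ ≠ 3)
    (hΔ₁ : ¬ (ℓ₁ : ℤ) ∣ discOf [a1, a2, a3, a4, a6]) (hΔ₂ : ¬ (ℓ₂ : ℤ) ∣ discOf [a1, a2, a3, a4, a6])
    {n₁ n₂ : ℕ} (hc₁ : countPoints [a1, a2, a3, a4, a6] ℓ₁ = n₁)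
    (hc₂ : countPoints [a1, a2, a3, a4, a6] ℓ₂ = n₂)
    (hirr : ∀ c : ZMod 3, c ^ 2 - (((ℓ₁ : ℤ) + 1 - n₁ : ℤ) : ZMod 3) * c + ℓ₁ ≠ 0)
    (hdet₂ : (ℓ₂ : ZMod 3) = 1) (htr₂ : (((ℓ₂ : ℤ) + 1 - n₂ : ℤ) : ZMod 3) = 2) (hsq : ¬ 9 ∣ n₂)
    (hGZK : rank_eq_analyticRank_of_analyticRank_le_one)
    (hCT : exists_casselsTate_pairing (K := ℚ))
    (W : WeierstrassCurve ℚ) (hW : W = ⟨a1, a2, a3, a4, a6⟩)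
    {N : ℕ} [NeZero N] {K : Type} [Field K] [NumberField K] (hKo : kolyvagin N W K)
    (hB : Kolyvagin1990_padicValNat_card_sha_le N W K) (hK : IsImaginaryQuadratic K)
    (hH : SatisfiesHeegnerHypothesis N K) {P : (W.baseChange K).toAffine.Point}
    (hP : IsHeegnerPoint N W K P) (hnt : ¬ IsOfFinAddOrder P)
    (hI : padicValNat 3 (AddSubgroup.zmultiples P).index ≤ 1)
    (Wd : WeierstrassCurve ℚ) [Wd.IsElliptic]
    (hWd : ∃ C : VariableChange ℚ, C • W.quadraticTwist ((NumberField.discr K : ℤ) : ℚ) = Wd)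
    (hrD : Wd.analyticRank ≤ 1)
    (hr : W.analyticRank = 1) {q : ℚ} (hq : shaAn W = (q : ℂ)) (hv : padicValRat 3 q = 2)
    (hSel : 3 ^ 3 ≤ Nat.card (W.selmerGroup (3 : ℤ))) :
    BSDp W 3 := by
  subst hW
  have h0 : discOf [a1, a2, a3, a4, a6] ≠ 0 := fun h ↦ hΔ₁ (by rw [h]; exact dvd_zero _)
  haveI hE : (⟨a1, a2, a3, a4, a6⟩ : WeierstrassCurve ℚ).IsElliptic :=
    X11b.isElliptic_of_discOf_ne_zero a1 a2 a3 a4 a6 h0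
  haveI := hmin
  haveI : Fact (Nat.Prime 3) := ⟨by norm_num⟩
  have hρ : Surj (⟨a1, a2, a3, a4, a6⟩ : WeierstrassCurve ℚ) 3 :=
    Supersingular.surj_three_of_ainvs_of_irr_of_order a1 a2 a3 a4 a6 hmin ℓ₁ ℓ₂ hℓ₁ hℓ₂ h2₁ h2₂ h3₁ h3₂
      hΔ₁ hΔ₂ hc₁ hc₂ hirr hdet₂ htr₂ hsq
  have hrank : (⟨a1, a2, a3, a4, a6⟩ : WeierstrassCurve ℚ).mordellWeilRank = 1 := by
    rw [(hGZK _ hr.le).1, hr]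
  have hirr3 : (⟨a1, a2, a3, a4, a6⟩ : WeierstrassCurve ℚ).HasIrreducibleModPGaloisRep 3 :=
    hasIrreducibleModPGaloisRep_of_hasSurjectiveModNGaloisRep _ 3 hρ
  have htors : ¬ 3 ∣ (⟨a1, a2, a3, a4, a6⟩ : WeierstrassCurve ℚ).torsionOrder := by
    have h := padicValNat_torsionOrder_eq_zero_of_irreducible (⟨a1, a2, a3, a4, a6⟩ : WeierstrassCurve ℚ) 3 hirr3
    haveI := (⟨a1, a2, a3, a4, a6⟩ : WeierstrassCurve ℚ).finite_torsion_point
    intro hdvd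
    have hpos : 0 < (⟨a1, a2, a3, a4, a6⟩ : WeierstrassCurve ℚ).torsionOrder := by
      unfold WeierstrassCurve.torsionOrder; exact Nat.card_pos
    have := one_le_padicValNat_of_dvd hpos.ne' hdvd
    omega
  haveI : Finite (⟨a1, a2, a3, a4, a6⟩ : WeierstrassCurve ℚ).sha := (hGZK _ hr.le).2
  obtain ⟨x, hx0, hx3⟩ := exists_sha_torsion_of_pow_rank_lt_card_selmerGroup
    (⟨a1, a2, a3, a4, a6⟩ : WeierstrassCurve ℚ) 3 hrank htors
    (by have h3 : ((3 : ℕ) : ℤ) = 3 := by norm_num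
        rw [h3]; exact lt_of_lt_of_le (by norm_num) hSel)
  have hdvd : 3 ^ (2 * 1 - 1) ∣ (⟨a1, a2, a3, a4, a6⟩ : WeierstrassCurve ℚ).shaOrder := by
    have hord : addOrderOf x = 3 := addOrderOf_eq_prime hx3 hx0
    rw [show 2 * 1 - 1 = 1 from rfl, pow_one, WeierstrassCurve.shaOrder, ← hord]
    exact addOrderOf_dvd_natCard x
  exact bsdp_of_kolyvagin_index_of_casselsTate_of_pow_dvd hGZK hCT _ hr.le K hKo hB hK hH hP hnt 3 (by norm_num) hρ
    Wd hWd hrD (k := 1) hI hq (by rw [hv]; norm_num) hdvd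

end Summit.BirchSwinnertonDyer.Rank1Residual.X11b

end
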